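import Summits.QuantumFields.YangMills.Theorems.UnitScaleTiltProp7TrueLinPureGauge
import Literature.MathematicalPhysics.QuantumFieldTheory.Balaban1983to89.B15DeterminingSets
import HarnessLib

/-!
# Route `UnitScaleTilt`, crux K1 «MinimiserStabilityRegPr» (stmt-QuantumFields-19200), route-R [RP] curved ∕ (α) (AVG-SYM) operator junction —
# THE CURVED N6, FIFTH BRICK: THE `k`-FOLD TRUE LINEARISATION ALONG THE BACKGROUND TOWER IS LINEAR AND EXACT ON PURE GAUGES,
# `T^{(k)}(U₀)[Y_ξ](c) = ξ(embIter k c₋) − Ū₀^{(k)}(c)·ξ(embIter k c₊)·Ū₀^{(k)}(c)*`, `Ū₀^{(k)} = Averaging.iter (blockAvg ℰp) k U₀`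

Cell `ym3-torus`, width seat `ym-ust-20520-w2` (g3, successor of g2); the `k`-fold iteration of this seat's brick 4 (✓ p603693
`Prop7TrueLinPureGauge.trueLin_pureGauge`) along the background's own (0.4) descent `U₀^{(j+1)} = avgFun ℰp U₀^{(j)}` (tree: `Averaging.iter`), for an
ABSTRACT composite `Q j` of the true one-step linearisations (★p1 g4's letters `Prop7AvgTrueLinearisation`, written out — no definition), in the tree's
«families characterised by their recursions» convention of `Prop7IterLinStructureRec.iterLin_eq_of_iterLambda` (`hQ0`, `hQs`).  THEOREMS ONLY (0 `def`,
0 `sorry`); `--supports stmt-QuantumFields-19200`, count-neutral.  YM₃ on T³ is a ladder rung (R3), not the Clay problem; nothing here claims the curved N6,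
S2, P, the crux or the gap.

WHY (CURVED-N6-LOCATED-w2g2.md §2 (R-A), and ★w4-19200 g2's M10(b)).  The curved structure theorem splits the `k`-fold true linearisation `T^{(k)}Y` as
`G_k + P_{Ū₀^{(k)}}Λ_k` with `P_V ξ(b) = ξ(b₋) − V_b ξ(b₊) V_b*` the pure-gauge (covariant-gradient) letter; the induction `T^{(j+1)}Y = T_j G_j + T_j P Λ_j`
needs exactly two facts about the one-step operator `T_j` at the level-`j` background: LINEARITY (§1) and EXACTNESS ON PURE GAUGES (brick 4).  Iterated (§2–§3):
`Q k` is linear and maps `P_{U₀}ξ` to `P_{Ū₀^{(k)}}(ξ ∘ embIter k)` under the per-level (0.4) guards `dist1(W^{(j)}_i(c)) < δ_N` (`j < k`), dischargeable from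
`PlaqSmall (α₀(L^k)⁻²) U₀` by `BlockAveragingEMLProp2.plaqSmall_iter_blockAvg_eml_level` ∘ `dist1_loopHol_le'` (not done here: the guard is displayed, as in brick 4).

WHAT IS PROVED (ns `…Theorems.Prop7TrueLinPureGaugeIter`).
* §1 `trueLin_add`, `trueLin_smul`, `trueLin_sub` — the true one-step operator (written out) is `ℂ`-linear in the bond field (`covWalkSum_add/_smul`, `map_add/_smul` of `fderiv`).
* §2 `iter_succ_apply`, `embIter_succ` (the two `rfl` letters of the tower), ★★ `trueLinIter_pureGauge` — the title identity for every recursion family `Q`.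
* §3 `trueLinIter_add`, `trueLinIter_smul`, `trueLinIter_sub`, ★ `trueLinIter_add_pureGauge` — `Q k (G + P_{U₀}ξ) = Q k G + P_{Ū₀^{(k)}}(ξ ∘ embIter k)`
  (the shape the (R-A) induction consumes).
HONEST SCOPE.  Algebra over bricks 2–4; no estimate.  The structure recursion `G_{j+1} = (T_j − P∘CM_j)G_j`, `Λ_{j+1} = CM_j(G_j) + Λ_j ∘ emb` and its bounds are the next files.

References: T. Bałaban, CMP 98 (1985) 17–51 [Balaban1985Averaging] ((11) p.19, (124) p.36); CMP 95 (1984) 17–40 [Balaban1984PropagatorsI] ((1.20) p.20);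
CMP 109 (1987) 249–301 [Balaban1987RG1] ((0.4), (0.11) p.253).
-/

noncomputable section

open scoped BigOperators Matrix.Norms.L2Operator

namespace Summit.QuantumFields.YangMills.Theorems.Prop7TrueLinPureGaugeIter

open Literature.MathematicalPhysics.QuantumFieldTheory.Balaban1983to89
open Finset T4Continuum BlockAveraging AveragingRT ExpMeanLog BlockAveragingEMLLinearised BlockAveragingEMLLinearisedBackground BlockAveragingEMLProp2
open B15DeterminingSets (embIter)
open Summit.QuantumFields.YangMills.Theorems.Prop7TrueLinPureGauge (trueLin_pureGauge)

variable {P : Params} {n : Type*} [Fintype n] [DecidableEq n] [Nonempty n] {j : ℕ}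

/-! ## §1 The true one-step operator is linear in the bond field -/

/-- The true one-step linearisation `T(V)Z(c) = D eml(W)[i ↦ Z_V(loop_i)·W_i]·κ* + κ·Z_V([y,y′])·κ*` is additive in `Z`. [cite: Balaban1985Averaging, (122) p.36] -/
theorem trueLin_add (V : GaugeField P j (Matrix.specialUnitaryGroup n ℂ)) (Z Z' : PBond P j → Matrix n n ℂ) (c : PBond P (j + 1)) :
    fderiv ℂ (eml : (Idx P → Matrix n n ℂ) → Matrix n n ℂ) (fun i => ((loopHol V c i : Matrix.specialUnitaryGroup n ℂ) : Matrix n n ℂ))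
          (fun i => covWalkSum V (Z + Z') (walk (emb c.src) (loopWord P.L c.dir (off i.1) i.2.1 i.2.2))
            * ((loopHol V c i : Matrix.specialUnitaryGroup n ℂ) : Matrix n n ℂ))
          * star ((corr (expMeanLogSU (n := n)) V c : Matrix.specialUnitaryGroup n ℂ) : Matrix n n ℂ)
        + ((corr (expMeanLogSU (n := n)) V c : Matrix.specialUnitaryGroup n ℂ) : Matrix n n ℂ)
          * covWalkSum V (Z + Z') (walk (emb c.src) (List.replicate P.L (c.dir, true)))
          * star ((corr (expMeanLogSU (n := n)) V c : Matrix.specialUnitaryGroup n ℂ) : Matrix n n ℂ)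
      = (fderiv ℂ (eml : (Idx P → Matrix n n ℂ) → Matrix n n ℂ) (fun i => ((loopHol V c i : Matrix.specialUnitaryGroup n ℂ) : Matrix n n ℂ))
            (fun i => covWalkSum V Z (walk (emb c.src) (loopWord P.L c.dir (off i.1) i.2.1 i.2.2))
              * ((loopHol V c i : Matrix.specialUnitaryGroup n ℂ) : Matrix n n ℂ))
            * star ((corr (expMeanLogSU (n := n)) V c : Matrix.specialUnitaryGroup n ℂ) : Matrix n n ℂ)
          + ((corr (expMeanLogSU (n := n)) V c : Matrix.specialUnitaryGroup n ℂ) : Matrix n n ℂ)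
            * covWalkSum V Z (walk (emb c.src) (List.replicate P.L (c.dir, true)))
            * star ((corr (expMeanLogSU (n := n)) V c : Matrix.specialUnitaryGroup n ℂ) : Matrix n n ℂ))
        + (fderiv ℂ (eml : (Idx P → Matrix n n ℂ) → Matrix n n ℂ) (fun i => ((loopHol V c i : Matrix.specialUnitaryGroup n ℂ) : Matrix n n ℂ))
            (fun i => covWalkSum V Z' (walk (emb c.src) (loopWord P.L c.dir (off i.1) i.2.1 i.2.2))
              * ((loopHol V c i : Matrix.specialUnitaryGroup n ℂ) : Matrix n n ℂ))
            * star ((corr (expMeanLogSU (n := n)) V c : Matrix.specialUnitaryGroup n ℂ) : Matrix n n ℂ)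
          + ((corr (expMeanLogSU (n := n)) V c : Matrix.specialUnitaryGroup n ℂ) : Matrix n n ℂ)
            * covWalkSum V Z' (walk (emb c.src) (List.replicate P.L (c.dir, true)))
            * star ((corr (expMeanLogSU (n := n)) V c : Matrix.specialUnitaryGroup n ℂ) : Matrix n n ℂ)) := by
  have hdir : (fun i : Idx P => covWalkSum V (Z + Z') (walk (emb c.src) (loopWord P.L c.dir (off i.1) i.2.1 i.2.2))
        * ((loopHol V c i : Matrix.specialUnitaryGroup n ℂ) : Matrix n n ℂ))
      = (fun i : Idx P => covWalkSum V Z (walk (emb c.src) (loopWord P.L c.dir (off i.1) i.2.1 i.2.2))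
          * ((loopHol V c i : Matrix.specialUnitaryGroup n ℂ) : Matrix n n ℂ))
        + (fun i : Idx P => covWalkSum V Z' (walk (emb c.src) (loopWord P.L c.dir (off i.1) i.2.1 i.2.2))
          * ((loopHol V c i : Matrix.specialUnitaryGroup n ℂ) : Matrix n n ℂ)) := by
    funext i
    simp only [Pi.add_apply, covWalkSum_add, add_mul]
  rw [hdir, map_add, covWalkSum_add]
  noncomm_ring

/-- The true one-step linearisation is `ℂ`-homogeneous in `Z`. [cite: Balaban1985Averaging, (122) p.36] -/
theorem trueLin_smul (V : GaugeField P j (Matrix.specialUnitaryGroup n ℂ)) (a : ℂ) (Z : PBond P j → Matrix n n ℂ) (c : PBond P (j + 1)) :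
    fderiv ℂ (eml : (Idx P → Matrix n n ℂ) → Matrix n n ℂ) (fun i => ((loopHol V c i : Matrix.specialUnitaryGroup n ℂ) : Matrix n n ℂ))
          (fun i => covWalkSum V (a • Z) (walk (emb c.src) (loopWord P.L c.dir (off i.1) i.2.1 i.2.2))
            * ((loopHol V c i : Matrix.specialUnitaryGroup n ℂ) : Matrix n n ℂ))
          * star ((corr (expMeanLogSU (n := n)) V c : Matrix.specialUnitaryGroup n ℂ) : Matrix n n ℂ)
        + ((corr (expMeanLogSU (n := n)) V c : Matrix.specialUnitaryGroup n ℂ) : Matrix n n ℂ)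
          * covWalkSum V (a • Z) (walk (emb c.src) (List.replicate P.L (c.dir, true)))
          * star ((corr (expMeanLogSU (n := n)) V c : Matrix.specialUnitaryGroup n ℂ) : Matrix n n ℂ)
      = a • (fderiv ℂ (eml : (Idx P → Matrix n n ℂ) → Matrix n n ℂ) (fun i => ((loopHol V c i : Matrix.specialUnitaryGroup n ℂ) : Matrix n n ℂ))
            (fun i => covWalkSum V Z (walk (emb c.src) (loopWord P.L c.dir (off i.1) i.2.1 i.2.2))
              * ((loopHol V c i : Matrix.specialUnitaryGroup n ℂ) : Matrix n n ℂ))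
            * star ((corr (expMeanLogSU (n := n)) V c : Matrix.specialUnitaryGroup n ℂ) : Matrix n n ℂ)
          + ((corr (expMeanLogSU (n := n)) V c : Matrix.specialUnitaryGroup n ℂ) : Matrix n n ℂ)
            * covWalkSum V Z (walk (emb c.src) (List.replicate P.L (c.dir, true)))
            * star ((corr (expMeanLogSU (n := n)) V c : Matrix.specialUnitaryGroup n ℂ) : Matrix n n ℂ)) := by
  have hdir : (fun i : Idx P => covWalkSum V (a • Z) (walk (emb c.src) (loopWord P.L c.dir (off i.1) i.2.1 i.2.2))
        * ((loopHol V c i : Matrix.specialUnitaryGroup n ℂ) : Matrix n n ℂ))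
      = a • (fun i : Idx P => covWalkSum V Z (walk (emb c.src) (loopWord P.L c.dir (off i.1) i.2.1 i.2.2))
          * ((loopHol V c i : Matrix.specialUnitaryGroup n ℂ) : Matrix n n ℂ)) := by
    funext i
    simp only [Pi.smul_apply, covWalkSum_smul, Matrix.smul_mul]
  rw [hdir, map_smul, covWalkSum_smul]
  simp only [smul_add, Matrix.smul_mul, Matrix.mul_smul]

/-- The true one-step linearisation respects differences in `Z`. [cite: Balaban1985Averaging, (122) p.36] -/
theorem trueLin_sub (V : GaugeField P j (Matrix.specialUnitaryGroup n ℂ)) (Z Z' : PBond P j → Matrix n n ℂ) (c : PBond P (j + 1)) :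
    fderiv ℂ (eml : (Idx P → Matrix n n ℂ) → Matrix n n ℂ) (fun i => ((loopHol V c i : Matrix.specialUnitaryGroup n ℂ) : Matrix n n ℂ))
          (fun i => covWalkSum V (Z - Z') (walk (emb c.src) (loopWord P.L c.dir (off i.1) i.2.1 i.2.2))
            * ((loopHol V c i : Matrix.specialUnitaryGroup n ℂ) : Matrix n n ℂ))
          * star ((corr (expMeanLogSU (n := n)) V c : Matrix.specialUnitaryGroup n ℂ) : Matrix n n ℂ)
        + ((corr (expMeanLogSU (n := n)) V c : Matrix.specialUnitaryGroup n ℂ) : Matrix n n ℂ)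
          * covWalkSum V (Z - Z') (walk (emb c.src) (List.replicate P.L (c.dir, true)))
          * star ((corr (expMeanLogSU (n := n)) V c : Matrix.specialUnitaryGroup n ℂ) : Matrix n n ℂ)
      = (fderiv ℂ (eml : (Idx P → Matrix n n ℂ) → Matrix n n ℂ) (fun i => ((loopHol V c i : Matrix.specialUnitaryGroup n ℂ) : Matrix n n ℂ))
            (fun i => covWalkSum V Z (walk (emb c.src) (loopWord P.L c.dir (off i.1) i.2.1 i.2.2))
              * ((loopHol V c i : Matrix.specialUnitaryGroup n ℂ) : Matrix n n ℂ))
            * star ((corr (expMeanLogSU (n := n)) V c : Matrix.specialUnitaryGroup n ℂ) : Matrix n n ℂ)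
          + ((corr (expMeanLogSU (n := n)) V c : Matrix.specialUnitaryGroup n ℂ) : Matrix n n ℂ)
            * covWalkSum V Z (walk (emb c.src) (List.replicate P.L (c.dir, true)))
            * star ((corr (expMeanLogSU (n := n)) V c : Matrix.specialUnitaryGroup n ℂ) : Matrix n n ℂ))
        - (fderiv ℂ (eml : (Idx P → Matrix n n ℂ) → Matrix n n ℂ) (fun i => ((loopHol V c i : Matrix.specialUnitaryGroup n ℂ) : Matrix n n ℂ))
            (fun i => covWalkSum V Z' (walk (emb c.src) (loopWord P.L c.dir (off i.1) i.2.1 i.2.2))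
              * ((loopHol V c i : Matrix.specialUnitaryGroup n ℂ) : Matrix n n ℂ))
            * star ((corr (expMeanLogSU (n := n)) V c : Matrix.specialUnitaryGroup n ℂ) : Matrix n n ℂ)
          + ((corr (expMeanLogSU (n := n)) V c : Matrix.specialUnitaryGroup n ℂ) : Matrix n n ℂ)
            * covWalkSum V Z' (walk (emb c.src) (List.replicate P.L (c.dir, true)))
            * star ((corr (expMeanLogSU (n := n)) V c : Matrix.specialUnitaryGroup n ℂ) : Matrix n n ℂ)) := by
  rw [sub_eq_add_neg Z Z', trueLin_add, ← neg_one_smul ℂ Z', trueLin_smul, neg_one_smul, ← sub_eq_add_neg]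

/-! ## §2 The tower letters and the `k`-fold exactness on pure gauges -/

/-- One more level of the background tower is one (0.4) average: `Ū₀^{(k+1)} = avgFun ℰp Ū₀^{(k)}` (`rfl`). [cite: Balaban1987RG1, (0.11) p.253] -/
theorem iter_succ_apply (U₀ : GaugeField P 0 (Matrix.specialUnitaryGroup n ℂ)) (k : ℕ) :
    Averaging.iter (fun i => blockAvg (P := P) (j := i) (expMeanLogSU (n := n))) (k + 1) U₀
      = avgFun (expMeanLogSU (n := n)) (Averaging.iter (fun i => blockAvg (P := P) (j := i) (expMeanLogSU (n := n))) k U₀) := rfl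

omit [Fintype n] [DecidableEq n] [Nonempty n] in
/-- One more level of the centre embedding: `embIter (k+1) y = embIter k (emb y)` (`rfl`). [cite: Balaban1987RG1, (0.1) p.251] -/
theorem embIter_succ (k : ℕ) (y : Site P (k + 1)) : embIter (k + 1) y = embIter k (emb y) := rfl

/-- ★★ **THE `k`-FOLD TRUE LINEARISATION IS EXACT ON PURE GAUGES.**  Let `Q k` be ANY composite of the true one-step linearisations along the background tower
`Ū₀^{(j)} = Averaging.iter (blockAvg ℰp) j U₀` (`hQ0 : Q 0 = id`, `hQs : Q (j+1) Y c = T(Ū₀^{(j)})[Q j Y](c)`).  If the (0.4) loop variables of every level `j < k`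
lie in the guard `dist1 < δ_N`, then for every site function `ξ` of the finest lattice
`Q k [b ↦ ξ(b₋) − U₀,b ξ(b₊) U₀,b*] (c) = ξ(embIter k c₋) − Ū₀^{(k)}(c)·ξ(embIter k c₊)·Ū₀^{(k)}(c)*` — the derivative of the exact covariance
`avg^k(g·U₀) = g^{(k)}·avg^k(U₀)·(g^{(k)})⁻¹` (`T4Continuum.iter_gaugeAct`), obtained by iterating brick 4. [cite: Balaban1985Averaging, (11) p.19, (124) p.36] -/
theorem trueLinIter_pureGauge (U₀ : GaugeField P 0 (Matrix.specialUnitaryGroup n ℂ))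
    (Q : (k : ℕ) → (PBond P 0 → Matrix n n ℂ) → PBond P k → Matrix n n ℂ) (hQ0 : ∀ Y, Q 0 Y = Y)
    (hQs : ∀ (k : ℕ) (Y : PBond P 0 → Matrix n n ℂ) (c : PBond P (k + 1)), Q (k + 1) Y c
      = fderiv ℂ (eml : (Idx P → Matrix n n ℂ) → Matrix n n ℂ)
            (fun i => ((loopHol (Averaging.iter (fun i => blockAvg (P := P) (j := i) (expMeanLogSU (n := n))) k U₀) c i :
              Matrix.specialUnitaryGroup n ℂ) : Matrix n n ℂ))
            (fun i => covWalkSum (Averaging.iter (fun i => blockAvg (P := P) (j := i) (expMeanLogSU (n := n))) k U₀) (Q k Y)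
                (walk (emb c.src) (loopWord P.L c.dir (off i.1) i.2.1 i.2.2))
              * ((loopHol (Averaging.iter (fun i => blockAvg (P := P) (j := i) (expMeanLogSU (n := n))) k U₀) c i :
                Matrix.specialUnitaryGroup n ℂ) : Matrix n n ℂ))
            * star ((corr (expMeanLogSU (n := n)) (Averaging.iter (fun i => blockAvg (P := P) (j := i) (expMeanLogSU (n := n))) k U₀) c :
                Matrix.specialUnitaryGroup n ℂ) : Matrix n n ℂ)
          + ((corr (expMeanLogSU (n := n)) (Averaging.iter (fun i => blockAvg (P := P) (j := i) (expMeanLogSU (n := n))) k U₀) c :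
                Matrix.specialUnitaryGroup n ℂ) : Matrix n n ℂ)
            * covWalkSum (Averaging.iter (fun i => blockAvg (P := P) (j := i) (expMeanLogSU (n := n))) k U₀) (Q k Y)
                (walk (emb c.src) (List.replicate P.L (c.dir, true)))
            * star ((corr (expMeanLogSU (n := n)) (Averaging.iter (fun i => blockAvg (P := P) (j := i) (expMeanLogSU (n := n))) k U₀) c :
                Matrix.specialUnitaryGroup n ℂ) : Matrix n n ℂ))
    (ξ : Site P 0 → Matrix n n ℂ) :
    ∀ k : ℕ, (∀ j < k, ∀ (c : PBond P (j + 1)) (i : Idx P),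
        dist1 (loopHol (Averaging.iter (fun i => blockAvg (P := P) (j := i) (expMeanLogSU (n := n))) j U₀) c i) < deltaSU n) →
      ∀ c : PBond P k, Q k (fun b : PBond P 0 => ξ b.src - ((U₀ b : Matrix.specialUnitaryGroup n ℂ) : Matrix n n ℂ) * ξ b.tgt *
            star ((U₀ b : Matrix.specialUnitaryGroup n ℂ) : Matrix n n ℂ)) c
        = ξ (embIter k c.src)
          - ((Averaging.iter (fun i => blockAvg (P := P) (j := i) (expMeanLogSU (n := n))) k U₀ c : Matrix.specialUnitaryGroup n ℂ) : Matrix n n ℂ)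
            * ξ (embIter k c.tgt)
            * star ((Averaging.iter (fun i => blockAvg (P := P) (j := i) (expMeanLogSU (n := n))) k U₀ c : Matrix.specialUnitaryGroup n ℂ) :
                Matrix n n ℂ) := by
  intro k
  induction k with
  | zero =>
    intro _ c
    rw [hQ0]
    rfl
  | succ k ih =>
    intro hg c
    have hfun : Q k (fun b : PBond P 0 => ξ b.src - ((U₀ b : Matrix.specialUnitaryGroup n ℂ) : Matrix n n ℂ) * ξ b.tgt *
          star ((U₀ b : Matrix.specialUnitaryGroup n ℂ) : Matrix n n ℂ))
        = fun b : PBond P k => (ξ ∘ embIter k) b.src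
          - ((Averaging.iter (fun i => blockAvg (P := P) (j := i) (expMeanLogSU (n := n))) k U₀ b : Matrix.specialUnitaryGroup n ℂ) : Matrix n n ℂ)
            * (ξ ∘ embIter k) b.tgt
            * star ((Averaging.iter (fun i => blockAvg (P := P) (j := i) (expMeanLogSU (n := n))) k U₀ b : Matrix.specialUnitaryGroup n ℂ) :
                Matrix n n ℂ) :=
      funext fun b => ih (fun j hj => hg j (Nat.lt_succ_of_lt hj)) b
    rw [hQs, hfun, trueLin_pureGauge (Averaging.iter (fun i => blockAvg (P := P) (j := i) (expMeanLogSU (n := n))) k U₀)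
      (ξ ∘ embIter k) c (hg k (Nat.lt_succ_self k) c)]
    rfl

/-! ## §3 The `k`-fold composite is linear -/

/-- Every recursion family `Q` of true one-step linearisations is additive. [cite: Balaban1985Averaging, (122) p.36] -/
theorem trueLinIter_add (U₀ : GaugeField P 0 (Matrix.specialUnitaryGroup n ℂ))
    (Q : (k : ℕ) → (PBond P 0 → Matrix n n ℂ) → PBond P k → Matrix n n ℂ) (hQ0 : ∀ Y, Q 0 Y = Y)
    (hQs : ∀ (k : ℕ) (Y : PBond P 0 → Matrix n n ℂ) (c : PBond P (k + 1)), Q (k + 1) Y c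
      = fderiv ℂ (eml : (Idx P → Matrix n n ℂ) → Matrix n n ℂ)
            (fun i => ((loopHol (Averaging.iter (fun i => blockAvg (P := P) (j := i) (expMeanLogSU (n := n))) k U₀) c i :
              Matrix.specialUnitaryGroup n ℂ) : Matrix n n ℂ))
            (fun i => covWalkSum (Averaging.iter (fun i => blockAvg (P := P) (j := i) (expMeanLogSU (n := n))) k U₀) (Q k Y)
                (walk (emb c.src) (loopWord P.L c.dir (off i.1) i.2.1 i.2.2))
              * ((loopHol (Averaging.iter (fun i => blockAvg (P := P) (j := i) (expMeanLogSU (n := n))) k U₀) c i :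
                Matrix.specialUnitaryGroup n ℂ) : Matrix n n ℂ))
            * star ((corr (expMeanLogSU (n := n)) (Averaging.iter (fun i => blockAvg (P := P) (j := i) (expMeanLogSU (n := n))) k U₀) c :
                Matrix.specialUnitaryGroup n ℂ) : Matrix n n ℂ)
          + ((corr (expMeanLogSU (n := n)) (Averaging.iter (fun i => blockAvg (P := P) (j := i) (expMeanLogSU (n := n))) k U₀) c :
                Matrix.specialUnitaryGroup n ℂ) : Matrix n n ℂ)
            * covWalkSum (Averaging.iter (fun i => blockAvg (P := P) (j := i) (expMeanLogSU (n := n))) k U₀) (Q k Y)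
                (walk (emb c.src) (List.replicate P.L (c.dir, true)))
            * star ((corr (expMeanLogSU (n := n)) (Averaging.iter (fun i => blockAvg (P := P) (j := i) (expMeanLogSU (n := n))) k U₀) c :
                Matrix.specialUnitaryGroup n ℂ) : Matrix n n ℂ)) :
    ∀ (k : ℕ) (Y Y' : PBond P 0 → Matrix n n ℂ) (c : PBond P k), Q k (Y + Y') c = Q k Y c + Q k Y' c := by
  intro k
  induction k with
  | zero => intro Y Y' c; rw [hQ0, hQ0, hQ0, Pi.add_apply]
  | succ k ih =>
    intro Y Y' c
    have hfun : Q k (Y + Y') = Q k Y + Q k Y' := funext fun b => by rw [Pi.add_apply]; exact ih Y Y' b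
    rw [hQs, hQs, hQs, hfun, trueLin_add]

/-- Every recursion family `Q` of true one-step linearisations is `ℂ`-homogeneous. [cite: Balaban1985Averaging, (122) p.36] -/
theorem trueLinIter_smul (U₀ : GaugeField P 0 (Matrix.specialUnitaryGroup n ℂ))
    (Q : (k : ℕ) → (PBond P 0 → Matrix n n ℂ) → PBond P k → Matrix n n ℂ) (hQ0 : ∀ Y, Q 0 Y = Y)
    (hQs : ∀ (k : ℕ) (Y : PBond P 0 → Matrix n n ℂ) (c : PBond P (k + 1)), Q (k + 1) Y c
      = fderiv ℂ (eml : (Idx P → Matrix n n ℂ) → Matrix n n ℂ)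
            (fun i => ((loopHol (Averaging.iter (fun i => blockAvg (P := P) (j := i) (expMeanLogSU (n := n))) k U₀) c i :
              Matrix.specialUnitaryGroup n ℂ) : Matrix n n ℂ))
            (fun i => covWalkSum (Averaging.iter (fun i => blockAvg (P := P) (j := i) (expMeanLogSU (n := n))) k U₀) (Q k Y)
                (walk (emb c.src) (loopWord P.L c.dir (off i.1) i.2.1 i.2.2))
              * ((loopHol (Averaging.iter (fun i => blockAvg (P := P) (j := i) (expMeanLogSU (n := n))) k U₀) c i :
                Matrix.specialUnitaryGroup n ℂ) : Matrix n n ℂ))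
            * star ((corr (expMeanLogSU (n := n)) (Averaging.iter (fun i => blockAvg (P := P) (j := i) (expMeanLogSU (n := n))) k U₀) c :
                Matrix.specialUnitaryGroup n ℂ) : Matrix n n ℂ)
          + ((corr (expMeanLogSU (n := n)) (Averaging.iter (fun i => blockAvg (P := P) (j := i) (expMeanLogSU (n := n))) k U₀) c :
                Matrix.specialUnitaryGroup n ℂ) : Matrix n n ℂ)
            * covWalkSum (Averaging.iter (fun i => blockAvg (P := P) (j := i) (expMeanLogSU (n := n))) k U₀) (Q k Y)
                (walk (emb c.src) (List.replicate P.L (c.dir, true)))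
            * star ((corr (expMeanLogSU (n := n)) (Averaging.iter (fun i => blockAvg (P := P) (j := i) (expMeanLogSU (n := n))) k U₀) c :
                Matrix.specialUnitaryGroup n ℂ) : Matrix n n ℂ)) :
    ∀ (k : ℕ) (a : ℂ) (Y : PBond P 0 → Matrix n n ℂ) (c : PBond P k), Q k (a • Y) c = a • Q k Y c := by
  intro k
  induction k with
  | zero => intro a Y c; rw [hQ0, hQ0, Pi.smul_apply]
  | succ k ih =>
    intro a Y c
    have hfun : Q k (a • Y) = a • Q k Y := funext fun b => by rw [Pi.smul_apply]; exact ih a Y b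
    rw [hQs, hQs, hfun, trueLin_smul]

/-- Every recursion family `Q` of true one-step linearisations respects differences. [cite: Balaban1985Averaging, (122) p.36] -/
theorem trueLinIter_sub (U₀ : GaugeField P 0 (Matrix.specialUnitaryGroup n ℂ))
    (Q : (k : ℕ) → (PBond P 0 → Matrix n n ℂ) → PBond P k → Matrix n n ℂ) (hQ0 : ∀ Y, Q 0 Y = Y)
    (hQs : ∀ (k : ℕ) (Y : PBond P 0 → Matrix n n ℂ) (c : PBond P (k + 1)), Q (k + 1) Y c
      = fderiv ℂ (eml : (Idx P → Matrix n n ℂ) → Matrix n n ℂ)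
            (fun i => ((loopHol (Averaging.iter (fun i => blockAvg (P := P) (j := i) (expMeanLogSU (n := n))) k U₀) c i :
              Matrix.specialUnitaryGroup n ℂ) : Matrix n n ℂ))
            (fun i => covWalkSum (Averaging.iter (fun i => blockAvg (P := P) (j := i) (expMeanLogSU (n := n))) k U₀) (Q k Y)
                (walk (emb c.src) (loopWord P.L c.dir (off i.1) i.2.1 i.2.2))
              * ((loopHol (Averaging.iter (fun i => blockAvg (P := P) (j := i) (expMeanLogSU (n := n))) k U₀) c i :
                Matrix.specialUnitaryGroup n ℂ) : Matrix n n ℂ))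
            * star ((corr (expMeanLogSU (n := n)) (Averaging.iter (fun i => blockAvg (P := P) (j := i) (expMeanLogSU (n := n))) k U₀) c :
                Matrix.specialUnitaryGroup n ℂ) : Matrix n n ℂ)
          + ((corr (expMeanLogSU (n := n)) (Averaging.iter (fun i => blockAvg (P := P) (j := i) (expMeanLogSU (n := n))) k U₀) c :
                Matrix.specialUnitaryGroup n ℂ) : Matrix n n ℂ)
            * covWalkSum (Averaging.iter (fun i => blockAvg (P := P) (j := i) (expMeanLogSU (n := n))) k U₀) (Q k Y)
                (walk (emb c.src) (List.replicate P.L (c.dir, true)))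
            * star ((corr (expMeanLogSU (n := n)) (Averaging.iter (fun i => blockAvg (P := P) (j := i) (expMeanLogSU (n := n))) k U₀) c :
                Matrix.specialUnitaryGroup n ℂ) : Matrix n n ℂ)) :
    ∀ (k : ℕ) (Y Y' : PBond P 0 → Matrix n n ℂ) (c : PBond P k), Q k (Y - Y') c = Q k Y c - Q k Y' c := by
  intro k Y Y' c
  rw [sub_eq_add_neg Y Y', trueLinIter_add U₀ Q hQ0 hQs, ← neg_one_smul ℂ Y', trueLinIter_smul U₀ Q hQ0 hQs, neg_one_smul, ← sub_eq_add_neg]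

/-- ★ **THE SHAPE THE (R-A) INDUCTION CONSUMES**: `Q k (G + P_{U₀}ξ) = Q k G + P_{Ū₀^{(k)}}(ξ ∘ embIter k)` — linearity and pure-gauge exactness together,
under the per-level (0.4) guards. [cite: Balaban1985Averaging, (11) p.19, (124) p.36] -/
theorem trueLinIter_add_pureGauge (U₀ : GaugeField P 0 (Matrix.specialUnitaryGroup n ℂ))
    (Q : (k : ℕ) → (PBond P 0 → Matrix n n ℂ) → PBond P k → Matrix n n ℂ) (hQ0 : ∀ Y, Q 0 Y = Y)
    (hQs : ∀ (k : ℕ) (Y : PBond P 0 → Matrix n n ℂ) (c : PBond P (k + 1)), Q (k + 1) Y c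
      = fderiv ℂ (eml : (Idx P → Matrix n n ℂ) → Matrix n n ℂ)
            (fun i => ((loopHol (Averaging.iter (fun i => blockAvg (P := P) (j := i) (expMeanLogSU (n := n))) k U₀) c i :
              Matrix.specialUnitaryGroup n ℂ) : Matrix n n ℂ))
            (fun i => covWalkSum (Averaging.iter (fun i => blockAvg (P := P) (j := i) (expMeanLogSU (n := n))) k U₀) (Q k Y)
                (walk (emb c.src) (loopWord P.L c.dir (off i.1) i.2.1 i.2.2))
              * ((loopHol (Averaging.iter (fun i => blockAvg (P := P) (j := i) (expMeanLogSU (n := n))) k U₀) c i :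
                Matrix.specialUnitaryGroup n ℂ) : Matrix n n ℂ))
            * star ((corr (expMeanLogSU (n := n)) (Averaging.iter (fun i => blockAvg (P := P) (j := i) (expMeanLogSU (n := n))) k U₀) c :
                Matrix.specialUnitaryGroup n ℂ) : Matrix n n ℂ)
          + ((corr (expMeanLogSU (n := n)) (Averaging.iter (fun i => blockAvg (P := P) (j := i) (expMeanLogSU (n := n))) k U₀) c :
                Matrix.specialUnitaryGroup n ℂ) : Matrix n n ℂ)
            * covWalkSum (Averaging.iter (fun i => blockAvg (P := P) (j := i) (expMeanLogSU (n := n))) k U₀) (Q k Y)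
                (walk (emb c.src) (List.replicate P.L (c.dir, true)))
            * star ((corr (expMeanLogSU (n := n)) (Averaging.iter (fun i => blockAvg (P := P) (j := i) (expMeanLogSU (n := n))) k U₀) c :
                Matrix.specialUnitaryGroup n ℂ) : Matrix n n ℂ))
    (G : PBond P 0 → Matrix n n ℂ) (ξ : Site P 0 → Matrix n n ℂ) {k : ℕ}
    (hg : ∀ j < k, ∀ (c : PBond P (j + 1)) (i : Idx P),
        dist1 (loopHol (Averaging.iter (fun i => blockAvg (P := P) (j := i) (expMeanLogSU (n := n))) j U₀) c i) < deltaSU n)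
    (c : PBond P k) :
    Q k (fun b : PBond P 0 => G b + (ξ b.src - ((U₀ b : Matrix.specialUnitaryGroup n ℂ) : Matrix n n ℂ) * ξ b.tgt *
            star ((U₀ b : Matrix.specialUnitaryGroup n ℂ) : Matrix n n ℂ))) c
      = Q k G c + (ξ (embIter k c.src)
          - ((Averaging.iter (fun i => blockAvg (P := P) (j := i) (expMeanLogSU (n := n))) k U₀ c : Matrix.specialUnitaryGroup n ℂ) : Matrix n n ℂ)
            * ξ (embIter k c.tgt)
            * star ((Averaging.iter (fun i => blockAvg (P := P) (j := i) (expMeanLogSU (n := n))) k U₀ c : Matrix.specialUnitaryGroup n ℂ) :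
                Matrix n n ℂ)) := by
  rw [← trueLinIter_pureGauge U₀ Q hQ0 hQs ξ k hg c, ← trueLinIter_add U₀ Q hQ0 hQs]
  rfl

end Summit.QuantumFields.YangMills.Theorems.Prop7TrueLinPureGaugeIter

end
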